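import Summits.HodgeConjecture.HodgeConjecture.Theses.EndoscopicMiddleDegree
import Literature.AlgebraicGeometry.Motives.ComplexPointsOrientation
import Literature.AlgebraicGeometry.HodgeTheory.GysinKernelProofs

/-!
# Route EndoscopicMiddleDegree — Assembly (item stmt-HodgeConjecture-14571)

The assembly item of route `route-HodgeConjecture-EndoscopicMiddleDegree` (rev 7) is the implication

`IsotypicMiddleClassesAlgebraic → OrthogonalEnveloped → OrthogonalSplit → CupProductAlgebraic →
SectorComplement → HodgeConjecture`,

literally the type of the route's deciding theorem
`Summit.HodgeConjecture.HodgeConjecture.Theses.EndoscopicMiddleDegree.closes`.  It is NOT a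
propositional tautology: its content is the glue from the four mathematical items to the route's
target `MiddleDegreeStep` (the Hodge conjecture propagates from degree `2m` into the middle degree
`2(m+1)` on a ball quotient `X` carrying `D : UnitaryBallQuotientDatum (2(m+1)) X`, `m ∈ {1, 2}`),
after which `SectorComplement : MiddleDegreeStep → HodgeConjecture` (the declared, unclaimed sector
frame) concludes.

The glue.  Given a rational Hodge `(m+1, m+1)`-class `c`, `OrthogonalSplit` puts `c` in the sum of
four subspaces of `H^{2(m+1)}(X(ℂ); ℂ)`, each of which lies in `algebraicClasses X (m + 1)`:

1. the special cycle classes `SC^{m+1}(D) ⊗ ℂ` (the `⨆` over totally positive definite `W ⊆ V` of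
   `E`-dimension `m + 1` of the classes supported on the special subvariety `c(W)`): `c(W)` is
   Zariski closed (`D.isClosed_specialSubvariety`) of codimension `≥ dim_E W = m + 1`
   (`D.le_coheight_of_mem_specialSubvariety`), so by `classesSupportedOn_le_supportedClasses`;
2. the classes supported on closed subsets `Z ⊆ c(W)` (`dim_E W = m`) of codimension `≥ m + 1`
   ("cycles on special cycles"): `classesSupportedOn_le_supportedClasses` verbatim;
3. the Lefschetz summand `span {a ∪ d}`, `a` rational Hodge `(m, m)`, `d ∈ algebraicClasses X 1`:
   `a` is algebraic by the degree-`2m` hypothesis of `MiddleDegreeStep`, and the product by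
   `CupProductAlgebraic` (`X` smooth projective by `D.isSmoothProjective`);
4. the theta-orthogonal kernel `span {e}` (`e` rational Hodge `(m+1, m+1)`, cup-orthogonal to the
   first three summands): `OrthogonalEnveloped` gives an algebraic self-correspondence `γ` whose
   action `P` preserves rational classes, has purely `(m+1, m+1)` image and fixes `e`, and
   `IsotypicMiddleClassesAlgebraic` makes such `P`-fixed rational classes algebraic.  Both cruxes
   are quantified over an orientation family `μ` with Poincaré duality (for the Gysin map `pr₁₊`);
   one is built here from complex orientations (`Motives.ComplexPoints.isOrientableOver`) and
   `OrientationFamily.hasPoincareDuality`.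

`sup_le`, `iSup_le` and `Submodule.span_le` assemble the four bounds.  The proof is self-contained
(it does not refer to `closes`), so it does not depend on the regeneration of the route file.
(Fullbuild repair 2026-08-16: the two Literature modules supplying `ComplexPoints.isOrientableOver` and
`OrientationFamily.hasPoincareDuality` are now imported here directly — the regenerated route file no
longer imports them transitively; nothing else changed.)
-/

-- `Summit.HodgeConjecture.HodgeConjecture.Theorems` is the mandated namespace (single-problem summit:
-- Problem = Summit), which `linter.dupNamespace` flags on every declaration; the lakefile turns the
-- linter off tree-wide (weak option), restated here so stand-alone elaboration is warning-free too.
set_option linter.dupNamespace false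

namespace Summit.HodgeConjecture.HodgeConjecture.Theorems

open Summit.HodgeConjecture.HodgeConjecture.Theses.EndoscopicMiddleDegree
open Literature.AlgebraicGeometry.HodgeTheory Literature.AlgebraicGeometry.ShimuraVarieties

/-- **Assembly of route EndoscopicMiddleDegree** (item stmt-HodgeConjecture-14571):
`IsotypicMiddleClassesAlgebraic → OrthogonalEnveloped → OrthogonalSplit → CupProductAlgebraic →
SectorComplement → HodgeConjecture`.  Via `SectorComplement` it suffices to prove
`MiddleDegreeStep`; split a rational Hodge `(m+1, m+1)`-class along `OrthogonalSplit` and bound the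
four summands: special cycle classes and cycles-on-special-cycles are algebraic
(`classesSupportedOn_le_supportedClasses` with the datum's closedness/codimension fields), the
Lefschetz summand by the degree-`2m` hypothesis and `CupProductAlgebraic`, and each theta-orthogonal
generator is enveloped (`OrthogonalEnveloped`) hence algebraic (`IsotypicMiddleClassesAlgebraic`),
the orientation family with Poincaré duality being the complex-orientation one. -/
theorem endoscopicMiddleDegree_assembly_proof :
    Summit.HodgeConjecture.HodgeConjecture.Theses.EndoscopicMiddleDegree.Assembly := by
  unfold Assembly
  intro h₁ h₂ h₃ h₉ hS
  refine hS fun m X hm1 hm2 hD hlow c hc hH ↦ ?_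
  obtain ⟨D⟩ := hD
  have hX : Literature.AlgebraicGeometry.Motives.IsSmoothProjective (2 * (m + 1)) X :=
    D.isSmoothProjective
  -- an orientation family with Poincaré duality (complex orientations; Hatcher Thm 3.30), for the
  -- Gysin maps in the two cruxes
  obtain ⟨μ, hμ⟩ : ∃ μ : OrientationFamily, μ.HasPoincareDuality :=
    ⟨fun _ _ h ↦ Classical.choice
        (Literature.AlgebraicGeometry.Motives.ComplexPoints.isOrientableOver ℂ h),
      OrientationFamily.hasPoincareDuality _⟩
  refine (?_ : _ ≤ algebraicClasses X (m + 1)) (h₃ m X D hm1 hm2 c hc hH)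
  refine sup_le (sup_le (sup_le ?_ ?_) ?_) ?_
  · -- (1) special cycles of codimension `m + 1` are algebraic
    refine iSup_le fun W ↦ iSup_le fun hW ↦ iSup_le fun hk ↦
      classesSupportedOn_le_supportedClasses (D.isClosed_specialSubvariety W hW) (fun z hz ↦ ?_) _
    have := D.le_coheight_of_mem_specialSubvariety W hW z hz
    rw [hk] at this
    exact_mod_cast this
  · -- (2) codimension-`(m+1)` cycles on the codimension-`m` special cycles are algebraic
    exact iSup_le fun _ ↦ iSup_le fun _ ↦ iSup_le fun _ ↦ iSup_le fun _ ↦ iSup_le fun hZ ↦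
      iSup_le fun _ ↦ iSup_le fun hk ↦ classesSupportedOn_le_supportedClasses hZ hk _
  · -- (3) the Lefschetz / product summand: HC in degree `2m` (the target's hypothesis) and
    -- cup products of algebraic classes
    refine Submodule.span_le.2 ?_
    rintro z ⟨a, ha, haH, d, hd, rfl⟩
    exact h₉ hX m 1 a d (hlow a ha haH) hd
  · -- (4) the theta-orthogonal kernel: enveloped (`OrthogonalEnveloped`), hence algebraic
    -- (`IsotypicMiddleClassesAlgebraic`)
    refine Submodule.span_le.2 ?_
    rintro e ⟨he, heH, horth⟩
    obtain ⟨γ, hγ, hrat, hhodge, hfix⟩ := h₂ μ hμ m X D hm1 hm2 e he heH horth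
    exact h₁ μ hμ m X D hm1 hm2 γ hγ hrat hhodge e he hfix

end Summit.HodgeConjecture.HodgeConjecture.Theorems
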